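import Summits.BirchSwinnertonDyer.BirchSwinnertonDyer.Theorems.PrintCFramBottomClassIndexLawFiveLeFlipRungTwoEightFlipIdentity
import Summits.BirchSwinnertonDyer.BirchSwinnertonDyer.Theorems.PrintCFramBottomClassIndexLawFiveLeFlipRungTwoEightJunk
import Summits.BirchSwinnertonDyer.BirchSwinnertonDyer.Theorems.PrintCFramBottomClassIndexLawFiveLeFlipRungTwoBracketMain
import HarnessLib

/-!
# Crux `PrintCFram.BottomClassIndexLawFiveLe` (stmt-BirchSwinnertonDyer-20372), line `eisenstein-resource-bdp-line` (registry v29 `stub_flipRungs.2`,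
# the `8 ∣ m` half = w6 g10's (JMLTwoEight⁶)): THE 2-ADIC FLIPPED-CUSP RUNG FOR `e = 3`, modular assembly piece P6g —
# THE BRACKET AT `W₁₆` IS `16^{−(k+1)}·(ODD + JUNK)`, AND ITS COEFFICIENTS AT THE FREQUENCIES `4 ∤ n` ARE THE MODULUS-`16` FLIP WEIGHTS TIMES `b(n)`
# (cell `bsd-print-cfram`, width seat `bsd-line-cfram-p1-w8` g10; THEOREMS ONLY, `--supports` 20372 `--as helper`; BSD is not proved by any of this)

HONEST FRAMING. Nothing here is a statement about BSD, elliptic curves or Bernoulli numbers; no registered stub is closed. This is the `R = 16` twin of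
w7 g9's (A2) `…FlipRungTwoBracketMain`. Data: `γ₀ = [[a,b],[M,256]] ∈ SL₂(ℤ)` (`256a − Mb = 1`), `g ∈ M_{(2k+1)/2}(4M, ψ)` with `q`-expansion `b`,
ANY weights `ω : ℕ → ℂ` and the translate sum `P = Σ_{j<16} ω(j)·g(· + j/16)` (the class cut of `g = G|U_4` at an EVEN class `2c (mod 16)`:
`ω(j) = e(−2cj/16)/16` — a `Γ₀`-form by w5 g9's square-class remark), solutions `y_j` of `j·M·y_j ≡ b (mod 16)` at the odd `j`, and w4 g20's BRACKET
`B₁₆(z) = 16^{−(k+1)}·P(γ₀•z)·(√((Mz+256)/16)^{2k+1})⁻¹` of the product vehicle `P·θ(16·)` (`…FlipRungTwoEightBracket`), read in the variable `w`,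
`z = 256•w` (base `16(Mw+1)` = P6c's):

  `B₁₆(256•w) = 16^{−(k+1)}·[ Σ_{j odd} ω_j g(j/16 +ᵥ γ₀•256w) + Σ_{j even} ω_j g(j/16 +ᵥ γ₀•256w) ]·(√(16(Mw+1))^{2k+1})⁻¹`;

  the ODD part is `Σ_n W(n) b(n) e(nw)` (P6c `hasSum_oddPartSixteen_flippedCusp_of_det`, `W(n)` = the raw weight sum
  `Σ_{j odd} ω_j ψ(d_j)(ε_{d_j}⁻¹ J(16M|d_j))^{2k+1} e(y_j n/16)`, `d_j = 16 − My_j`, evaluated by P6b), the EVEN part is `¼`-periodic in `w`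
  (P6d `junkTranslateSixteen_periodic_quarter_level`). Hence (w5 g8's generic `coeff_eq_of_periodic_junk` with `H = N/256`, period `¼`): if
  `B₁₆ = Σ_m c_B(m) 𝕢_N^m` (`256 ∣ N`; w4 g20's `bracketSixteen_analytic_and_hasSum` supplies it at `1024 ∣ N`) then for every `n` with `4 ∤ n`
  **`c_B(n·N/256) = 16^{−(k+1)}·W(n)·b(n)`**.

* §1 bookkeeping: `sum_range_sixteen_split`, the base `(M·(256•w)+256)/16 = 16(Mw+1)`, `𝕢_N(256•w) = 𝕢_{N/256}(w)`;
* §2 `hasSum_mainSixteen_qParam` — the ODD part divided by the base, as a `𝕢_{N/256}`-series supported on the multiples of `N/256`;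
* §3 `junkSixteen_vadd_quarter` — the EVEN part divided by the base is `¼`-periodic; §4 **`bracketSixteen_coeff_eq_flipWeight_mul`** — the displayed identity.

No definitions, no named facts, no `sorry`. beyond-print theorem: NO. References: [Shimura1973HalfIntegral] §1, Prop. 1.5; [DiamondShurman2005] §1.1;
crux notes w7g8-T6 §5c–§5d; w8 g10 STATUS 11:14:53Z; w4 g20 STATUS 12:03:42Z.
-/

set_option autoImplicit false
-- summit-side namespace `Summit.BirchSwinnertonDyer.BirchSwinnertonDyer.…` (single-conjunct summit, D-0017 layout)
set_option linter.dupNamespace false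

noncomputable section

open UpperHalfPlane hiding I
open Complex CongruenceSubgroup Function
open scoped MatrixGroups Real NumberTheorySymbols
open Literature.NumberTheory.EllipticCurves.ModularForms

namespace Summit.BirchSwinnertonDyer.BirchSwinnertonDyer.Theorems.PrintCFram.FlipRung

/-! ## §1 Bookkeeping -/

/-- `Σ_{j<16} F(j) = Σ_{j odd <16} F(j) + Σ_{j₁<8} F(2j₁)`. [folklore] -/
theorem sum_range_sixteen_split (F : ℕ → ℂ) :
    ∑ j ∈ Finset.range 16, F j = ∑ j ∈ ({1, 3, 5, 7, 9, 11, 13, 15} : Finset ℕ), F j + ∑ j₁ ∈ Finset.range 8, F (2 * j₁) := by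
  simp [Finset.sum_range_succ, Finset.sum_insert, Finset.sum_singleton]
  ring

/-- The dilation: `((256•w : ℍ) : ℂ) = 256·w`. [folklore] -/
theorem coe_twofiftysix_smul (w : ℍ) : ((((⟨256, by norm_num⟩ : {x : ℝ // 0 < x}) • w : ℍ)) : ℂ) = 256 * (w : ℂ) := by
  rw [coe_pos_real_smul]; simp [Complex.real_smul]

/-- The base of the bracket at `z = 256•w` is P6c's base: `(M·(256w) + 256)/16 = 16(Mw + 1)`. [folklore] -/
theorem bracketBaseSixteen_dilate (M : ℂ) (w : ℍ) :
    (M * ((((⟨256, by norm_num⟩ : {x : ℝ // 0 < x}) • w : ℍ)) : ℂ) + 256) / 16 = 16 * (M * w + 1) := by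
  rw [coe_twofiftysix_smul]; ring

/-- `𝕢_N(256•w) = 𝕢_{N/256}(w)` for `256 ∣ N`. [folklore] -/
theorem qParam_dilate256_eq {N : ℕ} (hN : 256 ∣ N) (w : ℍ) :
    Periodic.qParam (N : ℝ) ((((⟨256, by norm_num⟩ : {x : ℝ // 0 < x}) • w : ℍ)) : ℂ) = Periodic.qParam ((N / 256 : ℕ) : ℝ) (w : ℂ) := by
  obtain ⟨N₁, rfl⟩ := hN
  have h : (256 * N₁) / 256 = N₁ := by omega
  rw [h, coe_twofiftysix_smul]
  simp only [Periodic.qParam]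
  congr 1
  push_cast
  rcases Nat.eq_zero_or_pos N₁ with h0 | hpos
  · subst h0; simp
  · have : (N₁ : ℂ) ≠ 0 := by exact_mod_cast hpos.ne'
    field_simp

/-- P6c's base never vanishes: `√(16(Mw+1))^K ≠ 0`. [folklore] -/
theorem csqrt_baseSixteen_pow_ne_zero (M : ℕ) (w : ℍ) (K : ℕ) : Complex.sqrt (16 * ((M : ℂ) * w + 1)) ^ K ≠ 0 := by
  have hbase : (M : ℂ) * w + 1 ≠ 0 := by
    rcases Nat.eq_zero_or_pos M with hM | hM
    · subst hM; simp
    · intro h0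
      have h := congrArg Complex.im h0
      simp at h
      rcases h with h | h
      · omega
      · exact absurd h w.im_pos.ne'
  refine pow_ne_zero _ (fun h0 ↦ mul_ne_zero (by norm_num : (16 : ℂ) ≠ 0) hbase ?_)
  rw [← csqrt_sq (16 * ((M : ℂ) * w + 1)), h0]
  ring

/-! ## §2 The ODD part divided by the base, as a `𝕢_{N/256}`-series -/

/-- **THE MAIN TERM.** With P6c's `hasSum_oddPartSixteen_flippedCusp_of_det`: for `N₁ ≥ 1`,
`16^{−(k+1)}·(Σ_{j odd} ω_j g(j/16 +ᵥ γ₀•256w))·(√(16(Mw+1))^{2k+1})⁻¹ = Σ_K m(K) 𝕢_{N₁}(w)^K` with `m(n·N₁) = 16^{−(k+1)} W(n) b(n)` and `m = 0` off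
the multiples of `N₁`. [cite: Shimura1973HalfIntegral, Prop. 1.5] -/
theorem hasSum_mainSixteen_qParam {M : ℕ} {a b : ℤ} (hdet : 256 * a - (M : ℤ) * b = 1) (γ₀ : SL(2, ℤ))
    (h00 : (γ₀ 0 0 : ℤ) = a) (h01 : (γ₀ 0 1 : ℤ) = b) (h10 : (γ₀ 1 0 : ℤ) = M) (h11 : (γ₀ 1 1 : ℤ) = 256)
    (y : ℕ → ℤ) (hy : ∀ j ∈ ({1, 3, 5, 7, 9, 11, 13, 15} : Finset ℕ), (j : ℤ) * (M : ℤ) * y j ≡ b [ZMOD 16])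
    {k : ℕ} {ψ : DirichletCharacter ℂ (4 * M)} {g : ℍ → ℂ}
    (hg : ∀ γ ∈ Gamma0 (4 * M), ∀ z : ℍ, g (γ • z) = autFactor (2 * k + 1) (4 * M) ψ γ z * g z)
    (ω : ℕ → ℂ) {b' : ℕ → ℂ} (hb : ∀ τ : ℍ, HasSum (fun n ↦ b' n * Periodic.qParam 1 (τ : ℂ) ^ n) (g τ))
    {N₁ : ℕ} (hN₁ : 0 < N₁) (w : ℍ) :
    HasSum (fun K : ℕ ↦ (if N₁ ∣ K then ((16 : ℂ)⁻¹) ^ (k + 1) *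
        (∑ j ∈ ({1, 3, 5, 7, 9, 11, 13, 15} : Finset ℕ), ω j * (ψ (((16 - (M : ℤ) * y j : ℤ)) : ZMod (4 * M)) *
          ((thetaEps (16 - (M : ℤ) * y j))⁻¹ * (J(16 * (M : ℤ) | (16 - (M : ℤ) * y j).natAbs) : ℂ)) ^ (2 * k + 1)) *
            cexp (2 * π * Complex.I * ((y j * (K / N₁ : ℕ) : ℤ) : ℂ) / 16)) * b' (K / N₁) else 0) *
        Periodic.qParam (N₁ : ℝ) (w : ℂ) ^ K)
      (((16 : ℂ)⁻¹) ^ (k + 1) * (∑ j ∈ ({1, 3, 5, 7, 9, 11, 13, 15} : Finset ℕ), ω j *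
          g ((((j : ℝ) / 16) +ᵥ γ₀ • ((⟨256, by norm_num⟩ : {x : ℝ // 0 < x}) • w) : ℍ))) *
        (Complex.sqrt (16 * ((M : ℂ) * w + 1)) ^ (2 * k + 1))⁻¹) := by
  have hsq := csqrt_baseSixteen_pow_ne_zero M w (2 * k + 1)
  have h1 := (hasSum_oddPartSixteen_flippedCusp_of_det hdet γ₀ h00 h01 h10 h11 y hy hg ω hb w).mul_left
    (((16 : ℂ)⁻¹) ^ (k + 1) * (Complex.sqrt (16 * ((M : ℂ) * w + 1)) ^ (2 * k + 1))⁻¹)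
  have hval : ((16 : ℂ)⁻¹) ^ (k + 1) * (Complex.sqrt (16 * ((M : ℂ) * w + 1)) ^ (2 * k + 1))⁻¹ *
      (∑ j ∈ ({1, 3, 5, 7, 9, 11, 13, 15} : Finset ℕ), ω j *
        g ((((j : ℝ) / 16) +ᵥ γ₀ • ((⟨256, by norm_num⟩ : {x : ℝ // 0 < x}) • w) : ℍ))) =
      ((16 : ℂ)⁻¹) ^ (k + 1) * (∑ j ∈ ({1, 3, 5, 7, 9, 11, 13, 15} : Finset ℕ), ω j *
          g ((((j : ℝ) / 16) +ᵥ γ₀ • ((⟨256, by norm_num⟩ : {x : ℝ // 0 < x}) • w) : ℍ))) *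
        (Complex.sqrt (16 * ((M : ℂ) * w + 1)) ^ (2 * k + 1))⁻¹ := by ring
  rw [hval] at h1
  have h2 : HasSum (fun n : ℕ ↦ (((16 : ℂ)⁻¹) ^ (k + 1) *
      (∑ j ∈ ({1, 3, 5, 7, 9, 11, 13, 15} : Finset ℕ), ω j * (ψ (((16 - (M : ℤ) * y j : ℤ)) : ZMod (4 * M)) *
        ((thetaEps (16 - (M : ℤ) * y j))⁻¹ * (J(16 * (M : ℤ) | (16 - (M : ℤ) * y j).natAbs) : ℂ)) ^ (2 * k + 1)) *
          cexp (2 * π * Complex.I * ((y j * n : ℤ) : ℂ) / 16)) * b' n) * Periodic.qParam (N₁ : ℝ) (w : ℂ) ^ (n * N₁))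
      (((16 : ℂ)⁻¹) ^ (k + 1) * (∑ j ∈ ({1, 3, 5, 7, 9, 11, 13, 15} : Finset ℕ), ω j *
          g ((((j : ℝ) / 16) +ᵥ γ₀ • ((⟨256, by norm_num⟩ : {x : ℝ // 0 < x}) • w) : ℍ))) *
        (Complex.sqrt (16 * ((M : ℂ) * w + 1)) ^ (2 * k + 1))⁻¹) := by
    refine h1.congr_fun (fun n ↦ ?_)
    rw [← qParam_one_pow_eq_qParam_pow_mul hN₁ w n]
    field_simp
  have hinj : Function.Injective (fun n : ℕ ↦ n * N₁) := mul_left_injective₀ hN₁.ne'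
  rw [← hinj.hasSum_iff (fun K hK ↦ by
    rw [Set.mem_range, not_exists] at hK
    rw [if_neg (fun ⟨m, hm⟩ ↦ hK m (by rw [hm, mul_comm])), zero_mul])]
  refine h2.congr_fun (fun n ↦ ?_)
  simp only [Function.comp_apply]
  rw [if_pos (dvd_mul_left N₁ n), Nat.mul_div_cancel _ hN₁]

/-! ## §3 The EVEN part divided by the base is `¼`-periodic -/

/-- **THE JUNK IS `¼`-PERIODIC** (P6d `junkTranslateSixteen_periodic_quarter_level`, summed over the even translates): for any weights `ω` and
`g ∈ halfIntModularForms K (4M) ψ` (`M > 0`),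
`Σ_{j₁<8} ω(2j₁) g((2j₁)/16 +ᵥ γ₀•(256•(¼ +ᵥ w)))·(√(16(M(w+¼)+1))^K)⁻¹ = Σ_{j₁<8} ω(2j₁) g((2j₁)/16 +ᵥ γ₀•(256•w))·(√(16(Mw+1))^K)⁻¹`.
[cite: Shimura1973HalfIntegral, §1, Prop. 1.5] -/
theorem junkSixteen_vadd_quarter {M : ℕ} (hMpos : 0 < M) (γ₀ : SL(2, ℤ)) (h10 : (γ₀ 1 0 : ℤ) = M) (h11 : (γ₀ 1 1 : ℤ) = 256)
    {K : ℕ} {ψ : DirichletCharacter ℂ (4 * M)} {g : ℍ → ℂ} (hgm : g ∈ halfIntModularForms K (4 * M) ψ) (ω : ℕ → ℂ) (w : ℍ) :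
    (∑ j₁ ∈ Finset.range 8, ω (2 * j₁) *
        g (((((2 * j₁ : ℕ) : ℝ) / 16 : ℝ) +ᵥ γ₀ • ((⟨256, by norm_num⟩ : {x : ℝ // 0 < x}) • (((1 / 4 : ℝ) +ᵥ w) : ℍ)) : ℍ))) *
      (Complex.sqrt (16 * ((M : ℂ) * ((((1 / 4 : ℝ) +ᵥ w) : ℍ) : ℂ) + 1)) ^ K)⁻¹ =
    (∑ j₁ ∈ Finset.range 8, ω (2 * j₁) *
        g (((((2 * j₁ : ℕ) : ℝ) / 16 : ℝ) +ᵥ γ₀ • ((⟨256, by norm_num⟩ : {x : ℝ // 0 < x}) • w) : ℍ))) *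
      (Complex.sqrt (16 * ((M : ℂ) * w + 1)) ^ K)⁻¹ := by
  rw [Finset.sum_mul, Finset.sum_mul]
  refine Finset.sum_congr rfl (fun j₁ _ ↦ ?_)
  have h := junkTranslateSixteen_periodic_quarter_level (κ := K) hgm γ₀ h10 h11 hMpos (j₁ : ℤ)
    (⟨256, by norm_num⟩ : {x : ℝ // 0 < x}) rfl w
  have e8 : ((((2 * j₁ : ℕ) : ℝ) / 16 : ℝ)) = (((j₁ : ℤ) : ℝ) / 8) := by push_cast; ring
  rw [e8, mul_assoc, mul_assoc, h]

/-! ## §4 The coefficients of the bracket at the frequencies `4 ∤ n` -/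

/-- **THE BRACKET'S COEFFICIENTS OFF THE JUNK (modulus `16`).** Let `γ₀ = [[a,b],[M,256]]` (`256a − Mb = 1`, `M > 0`),
`g ∈ halfIntModularForms (2k+1) (4M) ψ` with `q`-expansion `b`, `ω` any weights, `P(z) = Σ_{j<16} ω(j) g(j/16 + z)`, `y_j` solutions of
`j·M·y_j ≡ b (mod 16)` at the odd `j`, `256 ∣ N`, and suppose w4 g20's bracket `B₁₆(z) = 16^{−(k+1)}·P(γ₀•z)·(√((Mz+256)/16)^{2k+1})⁻¹` has the
expansion `B₁₆ = Σ_m c_B(m) 𝕢_N^m` on `ℍ` (`…FlipRungTwoEightBracket.bracketSixteen_analytic_and_hasSum`). Then for every `n` with `4 ∤ n`: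
`c_B(n·N/256) = 16^{−(k+1)}·W(n)·b(n)`, `W(n) = Σ_{j odd} ω(j)·ψ(16−My_j)·(ε_{16−My_j}⁻¹ J(16M | 16−My_j))^{2k+1}·e(y_j n/16)` (P6c's raw weight; P6b
inverts it by an algebraic integer on `c ≡ n ≡ 2 (mod 4)`). Mechanism: `B₁₆(256•w) = MAIN(w) + JUNK(w)` with `MAIN` the odd translates (§2) and `JUNK`
the even ones (`¼`-periodic, §3); w5 g8's `coeff_eq_of_periodic_junk` with `H = N/256`, period `¼`. [cite: Shimura1973HalfIntegral, §1, Prop. 1.5]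
[cite: DiamondShurman2005, §1.1] -/
theorem bracketSixteen_coeff_eq_flipWeight_mul {M : ℕ} (hMpos : 0 < M) {a b : ℤ} (hdet : 256 * a - (M : ℤ) * b = 1) (γ₀ : SL(2, ℤ))
    (h00 : (γ₀ 0 0 : ℤ) = a) (h01 : (γ₀ 0 1 : ℤ) = b) (h10 : (γ₀ 1 0 : ℤ) = M) (h11 : (γ₀ 1 1 : ℤ) = 256)
    (y : ℕ → ℤ) (hy : ∀ j ∈ ({1, 3, 5, 7, 9, 11, 13, 15} : Finset ℕ), (j : ℤ) * (M : ℤ) * y j ≡ b [ZMOD 16])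
    {k : ℕ} {ψ : DirichletCharacter ℂ (4 * M)} {g : ℍ → ℂ} (hgm : g ∈ halfIntModularForms (2 * k + 1) (4 * M) ψ)
    {b' : ℕ → ℂ} (hb : ∀ τ : ℍ, HasSum (fun n ↦ b' n * Periodic.qParam 1 (τ : ℂ) ^ n) (g τ))
    (ω : ℕ → ℂ) {P : ℍ → ℂ} (hP : ∀ z : ℍ, P z = ∑ j ∈ Finset.range 16, ω j * g (((j : ℝ) / 16) +ᵥ z))
    {N : ℕ} (hN : 256 ∣ N) (hN0 : 0 < N) {cB : ℕ → ℂ}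
    (hB : ∀ z : ℍ, HasSum (fun m : ℕ ↦ cB m * Periodic.qParam (N : ℝ) (z : ℂ) ^ m)
      (((16 : ℂ)⁻¹) ^ (k + 1) * (P (γ₀ • z) * (Complex.sqrt (((M : ℂ) * z + 256) / 16) ^ (2 * k + 1))⁻¹)))
    (n : ℕ) (hn : ¬ 4 ∣ n) :
    cB (n * (N / 256)) = ((16 : ℂ)⁻¹) ^ (k + 1) *
      (∑ j ∈ ({1, 3, 5, 7, 9, 11, 13, 15} : Finset ℕ), ω j *
        (ψ (((16 - (M : ℤ) * y j : ℤ)) : ZMod (4 * M)) *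
          ((thetaEps (16 - (M : ℤ) * y j))⁻¹ * (J(16 * (M : ℤ) | (16 - (M : ℤ) * y j).natAbs) : ℂ)) ^ (2 * k + 1)) *
        cexp (2 * π * Complex.I * ((y j * n : ℤ) : ℂ) / 16)) * b' n := by
  have hg : ∀ γ ∈ Gamma0 (4 * M), ∀ z : ℍ, g (γ • z) = autFactor (2 * k + 1) (4 * M) ψ γ z * g z :=
    fun γ hγ z ↦ apply_smul_eq_of_mem (dvd_mul_right 4 M) hgm hγ z
  -- the period `H = N/256`
  set N₁ : ℕ := N / 256 with hN₁def
  have hNN₁ : N = 256 * N₁ := by rw [hN₁def]; exact (Nat.mul_div_cancel' hN).symm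
  have hN₁ : 0 < N₁ := by
    rcases Nat.eq_zero_or_pos N₁ with h | h
    · rw [h] at hNN₁; omega
    · exact h
  -- the three functions of `w`
  set T : ℍ → ℂ := fun w ↦ ((16 : ℂ)⁻¹) ^ (k + 1) * (P (γ₀ • ((⟨256, by norm_num⟩ : {x : ℝ // 0 < x}) • w)) *
    (Complex.sqrt (((M : ℂ) * ((((⟨256, by norm_num⟩ : {x : ℝ // 0 < x}) • w : ℍ)) : ℂ) + 256) / 16) ^ (2 * k + 1))⁻¹) with hT
  set MAIN : ℍ → ℂ := fun w ↦ ((16 : ℂ)⁻¹) ^ (k + 1) * (∑ j ∈ ({1, 3, 5, 7, 9, 11, 13, 15} : Finset ℕ), ω j *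
      g ((((j : ℝ) / 16) +ᵥ γ₀ • ((⟨256, by norm_num⟩ : {x : ℝ // 0 < x}) • w) : ℍ))) *
    (Complex.sqrt (16 * ((M : ℂ) * w + 1)) ^ (2 * k + 1))⁻¹ with hMAIN
  set JUNK : ℍ → ℂ := fun w ↦ ((16 : ℂ)⁻¹) ^ (k + 1) * (∑ j₁ ∈ Finset.range 8, ω (2 * j₁) *
      g (((((2 * j₁ : ℕ) : ℝ) / 16 : ℝ) +ᵥ γ₀ • ((⟨256, by norm_num⟩ : {x : ℝ // 0 < x}) • w) : ℍ))) *
    (Complex.sqrt (16 * ((M : ℂ) * w + 1)) ^ (2 * k + 1))⁻¹ with hJUNK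
  -- (1) `T = MAIN + JUNK`
  have hsplit : ∀ w : ℍ, T w = MAIN w + JUNK w := by
    intro w
    simp only [hT, hMAIN, hJUNK]
    rw [bracketBaseSixteen_dilate, hP, sum_range_sixteen_split]
    push_cast
    ring
  -- (2) the expansion of `T` in `𝕢_{N₁}(w)`
  have hTsum : ∀ w : ℍ, HasSum (fun K : ℕ ↦ cB K * Periodic.qParam (N₁ : ℝ) (w : ℂ) ^ K) (T w) := by
    intro w
    have h := hB ((⟨256, by norm_num⟩ : {x : ℝ // 0 < x}) • w)
    simp_rw [qParam_dilate256_eq hN w] at h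
    exact h
  -- (3) the expansion of `MAIN` and the periodicity of `JUNK`
  have hMsum := fun w : ℍ ↦ hasSum_mainSixteen_qParam hdet γ₀ h00 h01 h10 h11 y hy hg ω hb hN₁ w
  have hJ : ∀ w : ℍ, JUNK (((1 / 4 : ℝ) +ᵥ w) : ℍ) = JUNK w := by
    intro w
    simp only [hJUNK]
    rw [mul_assoc, junkSixteen_vadd_quarter hMpos γ₀ h10 h11 hgm ω w, ← mul_assoc]
  -- (4) the generic coefficient lemma
  have hH : (0 : ℝ) < (N₁ : ℝ) := by exact_mod_cast hN₁
  have hK : cexp (2 * π * Complex.I * (1 / 4 : ℝ) / (N₁ : ℝ) * ((n * N₁ : ℕ) : ℂ)) ≠ 1 := by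
    have h := cexp_two_pi_I_mul_div_ne_one (by norm_num : 0 < 4) hn
    have hN₁C : (N₁ : ℂ) ≠ 0 := by exact_mod_cast hN₁.ne'
    have e : (2 * π * Complex.I * (1 / 4 : ℝ) / (N₁ : ℝ) * ((n * N₁ : ℕ) : ℂ) : ℂ) =
        2 * π * Complex.I * ((n : ℂ) / ((4 : ℕ) : ℂ)) := by
      push_cast
      field_simp
    rwa [e]
  have hmain := coeff_eq_of_periodic_junk hH (1 / 4) hsplit hTsum hMsum hJ (n * N₁) hK
  rw [hmain, if_pos (dvd_mul_left N₁ n), Nat.mul_div_cancel _ hN₁]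

end Summit.BirchSwinnertonDyer.BirchSwinnertonDyer.Theorems.PrintCFram.FlipRung

end
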